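import Mathlib
import Summits.Ventures.PercRepro2.Defs
import Summits.Ventures.PercRepro2.Independence
import Summits.Ventures.PercRepro2.Harris
import Summits.Ventures.PercRepro2.Graph
import Summits.Ventures.PercRepro2.Exploration
import Summits.Ventures.PercRepro2.Events
import Summits.Ventures.PercRepro2.FourFunctions
import Summits.Ventures.PercRepro2.Induced
import Summits.Ventures.PercRepro2.Frontier
import Summits.Ventures.PercRepro2.ObsIndependence
import Summits.Ventures.PercRepro2.BHK
import Summits.Ventures.PercRepro2.BHKEvents
import Summits.Ventures.PercRepro2.OrderPreservation
import Summits.Ventures.PercRepro2.BHKAvoid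
import Summits.Ventures.PercRepro2.SameClusterAvoid
import Summits.Ventures.PercRepro2.CaseOneRegime
import Summits.Ventures.PercRepro2.CaseOnePos
import Summits.Ventures.PercRepro2.CaseOneJ11
import Summits.Ventures.PercRepro2.CaseOneRV
import Summits.Ventures.PercRepro2.CaseOnePendant
import Summits.Ventures.PercRepro2.CaseOnePendantAny
import Summits.Ventures.PercRepro2.CaseOnePendantNec
import Summits.Ventures.PercRepro2.CaseOneDWorld
import Summits.Ventures.PercRepro2.CaseOneDWorldPin
import Summits.Ventures.PercRepro2.HullDefs
import Summits.Ventures.PercRepro2.OneEdge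
import Summits.Ventures.PercRepro2.StarPattern
import Summits.Ventures.PercRepro2.HCov
import Summits.Ventures.PercRepro2.HCovSwap
import Summits.Ventures.PercRepro2.OddsLemma
import Summits.Ventures.PercRepro2.RV
import Summits.Ventures.PercRepro2.RVBridge
import Summits.Ventures.PercRepro2.CaseOneTwoMark

/-!
# `a₃` adjacent exactly to `o` and `b`: the mass identities
(blind cell PercRepro2, p1 g14; S5 §2.1 (K9) (j), proofs/P1-DWORLD.md §4e)

With `P₀` the law `p[eo ↦ 0][eb ↦ 0]` (both edges at `a₃` closed, `a₃` isolated) and the base events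
`Q₀ = {a₁ ↮ a₂}`, `O₁ = {a₁ ↔ o}`, `O₂ = {a₂ ↔ o}`, `B₁ = {a₁ ↔ b}`, `B₂ = {a₂ ↔ b}`, every mass of the
case-1 rung is a polynomial in `p_o = p eo`, `p_b = p eb` and the twelve base masses
`M, b, ob, bo₁, ob₁, o₁, b₁, o₁b₁, o₂, oU, bU, oUbU`:
`P(Q) = M − p_o p_b (bo₁ + ob₁)`, `P(Q, B₂) = b + p_o p_b (o₂ − ob − bo₁ − ob₁)`,
`P(Q, A) = p_o(1 − p_b) o₁ + (1 − p_o) p_b b₁ + p_o p_b (o₁ + b₁ − o₁b₁ − bo₁ − ob₁)`,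
`P(Q, A, O₂) = (1 − p_o) p_b ob₁`, `P(Q, A, B₂) = p_o (1 − p_b) bo₁`, `P(Q, A, B₂, O₂) = 0`
(`prob_Q_twoMark`, `prob_QB_twoMark`, `prob_QA_twoMark`, `prob_QAO_twoMark`, `prob_QAB_twoMark`,
`prob_QABO_twoMark`); the tool is `prob_twoPin` (probabilities by double pinning), built on
`expect_twoPin` of `CaseOneTwoMark.lean`. -/

namespace Summit.Ventures.PercRepro2

namespace CaseOne

/-! ## Probabilities under the double pinning -/

section Prob2
variable {E : Type*} [Fintype E] [DecidableEq E] {R : Type*} [CommRing R]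

/-- The `p[eo ↦ 0][eb ↦ 0]`-expectation of an indicator at the re-opened configuration is the
probability (under the same pinned weights) of the event it describes on the closed configurations. -/
lemma expect_indicator_openCC (p : E → R) (eo eb : E) (c c' : Bool) (S T : Set (Config E))
    (hST : ∀ ω : Config E, ω eo = false → ω eb = false → (openCC eo eb c c' ω ∈ S ↔ ω ∈ T)) :
    expect (Function.update (Function.update p eo 0) eb 0)
        (fun ω => S.indicator 1 (openCC eo eb c c' ω)) =
      prob (Function.update (Function.update p eo 0) eb 0) T := by
  rw [prob_eq_expect_indicator]
  refine expect_p00_congr _ _ _ _ _ fun ω ho hb => ?_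
  by_cases hω : ω ∈ T
  · rw [Set.indicator_of_mem hω, Set.indicator_of_mem ((hST ω ho hb).2 hω)]
    rfl
  · rw [Set.indicator_of_notMem hω, Set.indicator_of_notMem (fun h => hω ((hST ω ho hb).1 h))]

/-- **Probabilities by double pinning**: if the event `S` at the four re-opened configurations is
described on the closed configurations by `T₁₁, T₁₀, T₀₁, T₀₀`, then `P_p(S)` is the mixture of their
`p[eo ↦ 0][eb ↦ 0]`-probabilities. -/
theorem prob_twoPin (p : E → R) {eo eb : E} (hne : eo ≠ eb) (S T₁₁ T₁₀ T₀₁ T₀₀ : Set (Config E))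
    (h11 : ∀ ω : Config E, ω eo = false → ω eb = false → (openCC eo eb true true ω ∈ S ↔ ω ∈ T₁₁))
    (h10 : ∀ ω : Config E, ω eo = false → ω eb = false → (openCC eo eb true false ω ∈ S ↔ ω ∈ T₁₀))
    (h01 : ∀ ω : Config E, ω eo = false → ω eb = false → (openCC eo eb false true ω ∈ S ↔ ω ∈ T₀₁))
    (h00 : ∀ ω : Config E, ω eo = false → ω eb = false → (openCC eo eb false false ω ∈ S ↔ ω ∈ T₀₀)) :
    prob p S =
      p eo * (p eb * prob (Function.update (Function.update p eo 0) eb 0) T₁₁ +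
          (1 - p eb) * prob (Function.update (Function.update p eo 0) eb 0) T₁₀) +
      (1 - p eo) * (p eb * prob (Function.update (Function.update p eo 0) eb 0) T₀₁ +
          (1 - p eb) * prob (Function.update (Function.update p eo 0) eb 0) T₀₀) := by
  rw [prob_eq_expect_indicator, expect_twoPin p hne, expect_indicator_openCC p eo eb _ _ S T₁₁ h11,
    expect_indicator_openCC p eo eb _ _ S T₁₀ h10, expect_indicator_openCC p eo eb _ _ S T₀₁ h01,
    expect_indicator_openCC p eo eb _ _ S T₀₀ h00]

end Prob2

/-! ## The masses of the a₃ ~ {o, b} class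

Base events (both edges at `a₃` closed, weights `p[eo ↦ 0][eb ↦ 0]`): `Q₀ = {a₁ ↮ a₂}`,
`O₁ = {a₁ ↔ o}`, `O₂ = {a₂ ↔ o}`, `B₁ = {a₁ ↔ b}`, `B₂ = {a₂ ↔ b}`. Each probability in `G` is
a mixture of base probabilities (`prob_twoPin`); the pointwise descriptions come from Part 1. -/

section Masses
variable {V : Type*} {E : Type*} [Fintype E] [DecidableEq E] {R : Type*} [CommRing R]
variable {ends : E → Sym2 V} {o b a₃ : V} {eo eb : E}

omit [Fintype E] [DecidableEq E] in
/-- Connection is symmetric (iff form). -/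
lemma conn_comm_iff (ω : Config E) (u v : V) : Conn ends ω u v ↔ Conn ends ω v u :=
  ⟨conn_symm, conn_symm⟩

/-- **`P(Q)`** for `a₃ ~ {o, b}`: `P(Q) = M − p_o p_b (bo₁ + ob₁)` with
`M = P₀(Q₀)`, `bo₁ = P₀(Q₀, O₁, B₂)`, `ob₁ = P₀(Q₀, B₁, O₂)`. -/
theorem prob_Q_twoMark (p : E → R) (h : IsTwoMarkAt ends o b a₃ eo eb) {a₁ a₂ : V} (h1 : a₁ ≠ a₃)
    (h2 : a₂ ≠ a₃) :
    prob p (connEvent ends a₁ a₂)ᶜ =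
      prob (Function.update (Function.update p eo 0) eb 0) (connEvent ends a₁ a₂)ᶜ -
        p eo * p eb *
          (prob (Function.update (Function.update p eo 0) eb 0)
              ((connEvent ends a₁ a₂)ᶜ ∩ connEvent ends a₁ o ∩ connEvent ends a₂ b) +
            prob (Function.update (Function.update p eo 0) eb 0)
              ((connEvent ends a₁ a₂)ᶜ ∩ connEvent ends a₁ b ∩ connEvent ends a₂ o)) := by
  have key := prob_twoPin p h.ne (connEvent ends a₁ a₂)ᶜ
    ((connEvent ends a₁ a₂)ᶜ ∩ (connEvent ends a₁ o ∩ connEvent ends a₂ b)ᶜ ∩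
      (connEvent ends a₁ b ∩ connEvent ends a₂ o)ᶜ)
    (connEvent ends a₁ a₂)ᶜ (connEvent ends a₁ a₂)ᶜ (connEvent ends a₁ a₂)ᶜ ?_ ?_ ?_ ?_
  · -- the split of `Q₀` into the three pieces
    have s1 := prob_inter_add_prob_inter_compl (Function.update (Function.update p eo 0) eb 0)
      ((connEvent ends a₁ a₂)ᶜ ∩ (connEvent ends a₁ o ∩ connEvent ends a₂ b)ᶜ)
      (connEvent ends a₁ b ∩ connEvent ends a₂ o)
    have s2 := prob_inter_add_prob_inter_compl (Function.update (Function.update p eo 0) eb 0)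
      (connEvent ends a₁ a₂)ᶜ (connEvent ends a₁ o ∩ connEvent ends a₂ b)
    have e1 : (connEvent ends a₁ a₂)ᶜ ∩ (connEvent ends a₁ o ∩ connEvent ends a₂ b)ᶜ ∩
        (connEvent ends a₁ b ∩ connEvent ends a₂ o) =
        (connEvent ends a₁ a₂)ᶜ ∩ connEvent ends a₁ b ∩ connEvent ends a₂ o := by
      ext ω
      simp only [Set.mem_inter_iff, Set.mem_compl_iff, mem_connEvent]
      constructor
      · rintro ⟨⟨hq, _⟩, hb, ho⟩
        exact ⟨⟨hq, hb⟩, ho⟩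
      · rintro ⟨⟨hq, hb⟩, ho⟩
        refine ⟨⟨hq, fun ⟨ho1, _⟩ => hq (conn_trans ho1 (conn_symm ho))⟩, hb, ho⟩
    have e2 : (connEvent ends a₁ a₂)ᶜ ∩ (connEvent ends a₁ o ∩ connEvent ends a₂ b) =
        (connEvent ends a₁ a₂)ᶜ ∩ connEvent ends a₁ o ∩ connEvent ends a₂ b := by
      rw [Set.inter_assoc]
    rw [e1] at s1
    rw [e2] at s2
    rw [key]
    linear_combination (p eo * p eb) * (s1 + s2)
  · intro ω ho hb
    rw [openCC_tt ho hb]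
    simp only [Set.mem_compl_iff, Set.mem_inter_iff, mem_connEvent]
    rw [conn_both_iff h ω h1 h2, base2_eq_self ho hb, conn_comm_iff ω b a₂, conn_comm_iff ω o a₂]
    tauto
  · intro ω ho hb
    rw [openCC_tf h.ne ho hb]
    simp only [Set.mem_compl_iff, mem_connEvent]
    rw [conn_open_o_iff h ω h1 h2, base2_eq_self ho hb]
  · intro ω ho hb
    rw [openCC_ft ho hb]
    simp only [Set.mem_compl_iff, mem_connEvent]
    rw [conn_open_b_iff h ω h1 h2, base2_eq_self ho hb]
  · intro ω ho hb
    rw [openCC_ff ho hb, base2_eq_self ho hb]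

/-- `prob` respects set equality. -/
lemma prob_congr_set (p : E → R) {A B : Set (Config E)} (hAB : A = B) : prob p A = prob p B := by
  rw [hAB]

/-- **`P(Q, b ∈ C₂)`** for `a₃ ~ {o, b}`: `P(Q, B₂) = b + p_o p_b (o₂ − ob − bo₁ − ob₁)` with
`b = P₀(Q₀, B₂)`, `o₂ = P₀(Q₀, O₂)`, `ob = P₀(Q₀, O₂, B₂)`, `bo₁ = P₀(Q₀, O₁, B₂)`, `ob₁ = P₀(Q₀, B₁, O₂)`. -/
theorem prob_QB_twoMark (p : E → R) (h : IsTwoMarkAt ends o b a₃ eo eb) {a₁ a₂ : V} (h1 : a₁ ≠ a₃)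
    (h2 : a₂ ≠ a₃) :
    prob p ((connEvent ends a₁ a₂)ᶜ ∩ connEvent ends a₂ b) =
      prob (Function.update (Function.update p eo 0) eb 0)
          ((connEvent ends a₁ a₂)ᶜ ∩ connEvent ends a₂ b) +
        p eo * p eb *
          (prob (Function.update (Function.update p eo 0) eb 0)
              ((connEvent ends a₁ a₂)ᶜ ∩ connEvent ends a₂ o) -
            prob (Function.update (Function.update p eo 0) eb 0)
              ((connEvent ends a₁ a₂)ᶜ ∩ connEvent ends a₂ o ∩ connEvent ends a₂ b) -
            prob (Function.update (Function.update p eo 0) eb 0)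
              ((connEvent ends a₁ a₂)ᶜ ∩ connEvent ends a₁ o ∩ connEvent ends a₂ b) -
            prob (Function.update (Function.update p eo 0) eb 0)
              ((connEvent ends a₁ a₂)ᶜ ∩ connEvent ends a₁ b ∩ connEvent ends a₂ o)) := by
  set p00 := Function.update (Function.update p eo 0) eb 0 with hp00
  have key := prob_twoPin p h.ne ((connEvent ends a₁ a₂)ᶜ ∩ connEvent ends a₂ b)
    (((connEvent ends a₁ a₂)ᶜ ∩ connEvent ends a₂ b ∩ (connEvent ends a₁ o)ᶜ) ∪
      ((connEvent ends a₁ a₂)ᶜ ∩ connEvent ends a₂ o ∩ (connEvent ends a₂ b)ᶜ ∩ (connEvent ends a₁ b)ᶜ))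
    ((connEvent ends a₁ a₂)ᶜ ∩ connEvent ends a₂ b) ((connEvent ends a₁ a₂)ᶜ ∩ connEvent ends a₂ b)
    ((connEvent ends a₁ a₂)ᶜ ∩ connEvent ends a₂ b) ?_ ?_ ?_ ?_
  · rw [key, ← hp00]
    rw [prob_union_of_disjoint p00 (Set.disjoint_left.2 fun ω hω hω' => hω'.1.2 hω.1.2)]
    have s1 := prob_inter_add_prob_inter_compl p00 ((connEvent ends a₁ a₂)ᶜ ∩ connEvent ends a₂ b)
      (connEvent ends a₁ o)
    have s2 := prob_inter_add_prob_inter_compl p00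
      ((connEvent ends a₁ a₂)ᶜ ∩ connEvent ends a₂ o ∩ (connEvent ends a₂ b)ᶜ) (connEvent ends a₁ b)
    have s3 := prob_inter_add_prob_inter_compl p00 ((connEvent ends a₁ a₂)ᶜ ∩ connEvent ends a₂ o)
      (connEvent ends a₂ b)
    have e1 : (connEvent ends a₁ a₂)ᶜ ∩ connEvent ends a₂ b ∩ connEvent ends a₁ o =
        (connEvent ends a₁ a₂)ᶜ ∩ connEvent ends a₁ o ∩ connEvent ends a₂ b := Set.inter_right_comm _ _ _
    have e2 : (connEvent ends a₁ a₂)ᶜ ∩ connEvent ends a₂ o ∩ (connEvent ends a₂ b)ᶜ ∩ connEvent ends a₁ b =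
        (connEvent ends a₁ a₂)ᶜ ∩ connEvent ends a₁ b ∩ connEvent ends a₂ o := by
      ext ω
      simp only [Set.mem_inter_iff, Set.mem_compl_iff, mem_connEvent]
      have t2 : Conn ends ω a₁ b → Conn ends ω a₂ b → Conn ends ω a₁ a₂ :=
        fun x y => conn_trans x (conn_symm y)
      tauto
    rw [e1] at s1
    rw [e2] at s2
    linear_combination (p eo * p eb) * (s1 + s2 + s3)
  · intro ω ho hb
    rw [openCC_tt ho hb]
    simp only [Set.mem_compl_iff, Set.mem_inter_iff, Set.mem_union, mem_connEvent]
    rw [conn_both_iff h ω h1 h2, conn_both_iff h ω h2 h.ne_b, base2_eq_self ho hb,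
      conn_comm_iff ω b a₂, conn_comm_iff ω o a₂]
    have hbb := conn_refl ends ω b
    have t1 : Conn ends ω a₁ o → Conn ends ω a₂ o → Conn ends ω a₁ a₂ :=
      fun x y => conn_trans x (conn_symm y)
    have t2 : Conn ends ω a₁ b → Conn ends ω a₂ b → Conn ends ω a₁ a₂ :=
      fun x y => conn_trans x (conn_symm y)
    tauto
  · intro ω ho hb
    rw [openCC_tf h.ne ho hb]
    simp only [Set.mem_compl_iff, Set.mem_inter_iff, mem_connEvent]
    rw [conn_open_o_iff h ω h1 h2, conn_open_o_iff h ω h2 h.ne_b, base2_eq_self ho hb]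
  · intro ω ho hb
    rw [openCC_ft ho hb]
    simp only [Set.mem_compl_iff, Set.mem_inter_iff, mem_connEvent]
    rw [conn_open_b_iff h ω h1 h2, conn_open_b_iff h ω h2 h.ne_b, base2_eq_self ho hb]
  · intro ω ho hb
    rw [openCC_ff ho hb, base2_eq_self ho hb]

/-- **`P(Q, a₃ ∈ C₁)`** for `a₃ ~ {o, b}`:
`P(Q, A) = p_o(1 − p_b) o₁ + (1 − p_o) p_b b₁ + p_o p_b (o₁ + b₁ − o₁b₁ − bo₁ − ob₁)` with
`o₁ = P₀(Q₀, O₁)`, `b₁ = P₀(Q₀, B₁)`, `o₁b₁ = P₀(Q₀, O₁, B₁)`, `bo₁ = P₀(Q₀, O₁, B₂)`, `ob₁ = P₀(Q₀, B₁, O₂)`. -/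
theorem prob_QA_twoMark (p : E → R) (h : IsTwoMarkAt ends o b a₃ eo eb) {a₁ a₂ : V} (h1 : a₁ ≠ a₃)
    (h2 : a₂ ≠ a₃) :
    prob p ((connEvent ends a₁ a₂)ᶜ ∩ connEvent ends a₁ a₃) =
      p eo * (1 - p eb) *
          prob (Function.update (Function.update p eo 0) eb 0)
            ((connEvent ends a₁ a₂)ᶜ ∩ connEvent ends a₁ o) +
        (1 - p eo) * p eb *
          prob (Function.update (Function.update p eo 0) eb 0)
            ((connEvent ends a₁ a₂)ᶜ ∩ connEvent ends a₁ b) +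
        p eo * p eb *
          (prob (Function.update (Function.update p eo 0) eb 0)
              ((connEvent ends a₁ a₂)ᶜ ∩ connEvent ends a₁ o) +
            prob (Function.update (Function.update p eo 0) eb 0)
              ((connEvent ends a₁ a₂)ᶜ ∩ connEvent ends a₁ b) -
            prob (Function.update (Function.update p eo 0) eb 0)
              ((connEvent ends a₁ a₂)ᶜ ∩ connEvent ends a₁ o ∩ connEvent ends a₁ b) -
            prob (Function.update (Function.update p eo 0) eb 0)
              ((connEvent ends a₁ a₂)ᶜ ∩ connEvent ends a₁ o ∩ connEvent ends a₂ b) -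
            prob (Function.update (Function.update p eo 0) eb 0)
              ((connEvent ends a₁ a₂)ᶜ ∩ connEvent ends a₁ b ∩ connEvent ends a₂ o)) := by
  set p00 := Function.update (Function.update p eo 0) eb 0 with hp00
  have key := prob_twoPin p h.ne ((connEvent ends a₁ a₂)ᶜ ∩ connEvent ends a₁ a₃)
    (((connEvent ends a₁ a₂)ᶜ ∩ connEvent ends a₁ o ∩ (connEvent ends a₂ b)ᶜ) ∪
      ((connEvent ends a₁ a₂)ᶜ ∩ connEvent ends a₁ b ∩ (connEvent ends a₁ o)ᶜ ∩ (connEvent ends a₂ o)ᶜ))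
    ((connEvent ends a₁ a₂)ᶜ ∩ connEvent ends a₁ o) ((connEvent ends a₁ a₂)ᶜ ∩ connEvent ends a₁ b)
    ∅ ?_ ?_ ?_ ?_
  · rw [key, ← hp00, prob_empty]
    rw [prob_union_of_disjoint p00 (Set.disjoint_left.2 fun ω hω hω' => hω'.1.2 hω.1.2)]
    have s1 := prob_inter_add_prob_inter_compl p00 ((connEvent ends a₁ a₂)ᶜ ∩ connEvent ends a₁ o)
      (connEvent ends a₂ b)
    have s2 := prob_inter_add_prob_inter_compl p00
      ((connEvent ends a₁ a₂)ᶜ ∩ connEvent ends a₁ b ∩ (connEvent ends a₁ o)ᶜ) (connEvent ends a₂ o)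
    have s3 := prob_inter_add_prob_inter_compl p00 ((connEvent ends a₁ a₂)ᶜ ∩ connEvent ends a₁ b)
      (connEvent ends a₁ o)
    have e2 : (connEvent ends a₁ a₂)ᶜ ∩ connEvent ends a₁ b ∩ (connEvent ends a₁ o)ᶜ ∩ connEvent ends a₂ o =
        (connEvent ends a₁ a₂)ᶜ ∩ connEvent ends a₁ b ∩ connEvent ends a₂ o := by
      ext ω
      simp only [Set.mem_inter_iff, Set.mem_compl_iff, mem_connEvent]
      have t1 : Conn ends ω a₁ o → Conn ends ω a₂ o → Conn ends ω a₁ a₂ :=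
        fun x y => conn_trans x (conn_symm y)
      tauto
    have e3 : (connEvent ends a₁ a₂)ᶜ ∩ connEvent ends a₁ b ∩ connEvent ends a₁ o =
        (connEvent ends a₁ a₂)ᶜ ∩ connEvent ends a₁ o ∩ connEvent ends a₁ b := Set.inter_right_comm _ _ _
    rw [e2] at s2
    rw [e3] at s3
    linear_combination (p eo * p eb) * (s1 + s2 + s3)
  · intro ω ho hb
    rw [openCC_tt ho hb]
    simp only [Set.mem_compl_iff, Set.mem_inter_iff, Set.mem_union, mem_connEvent]
    rw [conn_both_iff h ω h1 h2, conn_both_a3_iff h ω h1, base2_eq_self ho hb,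
      conn_comm_iff ω b a₂, conn_comm_iff ω o a₂]
    have t1 : Conn ends ω a₁ o → Conn ends ω a₂ o → Conn ends ω a₁ a₂ :=
      fun x y => conn_trans x (conn_symm y)
    have t2 : Conn ends ω a₁ b → Conn ends ω a₂ b → Conn ends ω a₁ a₂ :=
      fun x y => conn_trans x (conn_symm y)
    tauto
  · intro ω ho hb
    rw [openCC_tf h.ne ho hb]
    simp only [Set.mem_compl_iff, Set.mem_inter_iff, mem_connEvent]
    rw [conn_open_o_iff h ω h1 h2, conn_open_o_a3_iff h ω h1, base2_eq_self ho hb]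
  · intro ω ho hb
    rw [openCC_ft ho hb]
    simp only [Set.mem_compl_iff, Set.mem_inter_iff, mem_connEvent]
    rw [conn_open_b_iff h ω h1 h2, conn_open_b_a3_iff h ω h1, base2_eq_self ho hb]
  · intro ω ho hb
    rw [openCC_ff ho hb]
    simp only [Set.mem_compl_iff, Set.mem_inter_iff, mem_connEvent, Set.mem_empty_iff_false,
      iff_false]
    exact fun hh => not_conn_base2 h ω h1 hh.2

end Masses

end CaseOne

end Summit.Ventures.PercRepro2
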